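import Mathlib
import Summits.NavierStokesRegularity.NavierStokesRegularity.Theorems.ThreadingFluxHorizonTowerMixedBracketCoreB
import HarnessLib

/-!
# Crux `PoloidalLiouville` (stmt-NavierStokesRegularity-1222, W1/W2), crux idea «horizon-threading-tower» (ns-idea-15):
# MIXED-DEGREE BRACKET RIGIDITY, core C — `N·ρ·D(A) = 0` and the degenerate branch, first steps

Support file (Theorems-side tooling; seat ns-wall-eng-3 g3, cell ns-wall-extremal, W1 adjunct; `--supports
stmt-NavierStokesRegularity-1222`, helper).  Part of the kernel proof of ★ MIXED-DEGREE BRACKET RIGIDITY: two non-zero real solid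
harmonics `A`, `B` on `ℝ³` of DIFFERENT degrees `l ≠ m` whose loop bracket `det(x, ∇A, ∇B)` vanishes identically are zonal about a
common axis — equivalently (ns-idea-15 «horizon-threading-tower», `OrderOneSphereEuler`): a TWO-SHELL scale-free profile
`U = U_{H_l} + U_{H_m}` passes the ORDER-ONE horizon law only if it is axisymmetric without swirl (the two-shell case of the conjecture
`HorizonTower.HorizonTowerZonality` at order one).  METHOD (pure polynomial algebra in `ℝ[x₀,x₁,x₂]`, formal partial derivatives):
Cramer decomposition `|x×∇A|²·∇B = P₁ x + P₂ ∇A`; its curl (⇒ `P₁/|x×∇A|²`, `P₂/|x×∇A|²` are first integrals of `L = (x × ∇A)·∇`)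
and divergence; the gradient of `β = P₂/|x×∇A|²` decomposed once more (`|x×∇A|²·∇β ∝ c₁ x + M ∇A`) and its curl; then
`L` applied to the divergence identity gives `N · ρ · det(∇A, ∇|∇A|², x) = 0` in the domain `ℝ[x]` with `N = (m+1)ρP₁ + l(m−l)AP₂`;
the branch `N = 0` forces `A∇B − B∇A` radial and dies on `(m−l)(l+m+1)AB = 0`; so `A` is det-zonal, hence zonal by ns-wall-eng-5 g4's
`Zonal.detZonal_allDegrees` machinery, and `B` follows by `Zonal.zonal_partner_of_bracket` (p688869).
HONEST LABEL: algebra toward one crux idea's typed conjecture; `HorizonTowerZonality` (general profiles), `PoloidalLiouville` (1222),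
`UnthreadedRigidity` (27585), 23843 and NS regularity remain OPEN; W1/W2 movement 0.  [folklore]
-/

-- the summit and its single problem share the name (D-0017 nested layout)
set_option linter.dupNamespace false

noncomputable section

open MvPolynomial Finsupp

namespace Summit.NavierStokesRegularity.NavierStokesRegularity.Theorems.PoloidalLiouville.HorizonTower.Zonal

section Stages

variable {l m : ℕ} {A B : RPoly}

/-- Stage I9: `N · ρ · D(A) = 0` — from `M = −Wq N`, the flatness of `N`, `Wq·LM = 3M·LWq` and `L Wq = ρ·D(A)`. -/
theorem stageI9 (hl : 1 ≤ l) (hm : 1 ≤ m) (hA : A.IsHomogeneous l) (hB : B.IsHomogeneous m) (hlA : lapP A = 0)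
    (hlB : lapP B = 0) (hA0 : A ≠ 0) (hD : detP A B = 0) : nn l m A B * (rhoP * DP A) = 0 := by
  obtain ⟨F1, F2⟩ := stageF hA hB hlA hlB hD
  have I3 := stageI3 hl hm hA hB hlA hlB hD
  have I8 := stageI8 hA hB hlA hlB hD
  set a0 := pderiv 0 A with ha0
  set a1 := pderiv 1 A with ha1
  set a2 := pderiv 2 A with ha2
  set b0 := pderiv 0 B with hb0
  set b1 := pderiv 1 B with hb1
  set b2 := pderiv 2 B with hb2
  set ρ : RPoly := rhoP with hρ'
  set G : RPoly := gP A with hG'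
  set H : RPoly := hP A B with hH'
  set Wq : RPoly := wq l A with hWq'
  set P₁ : RPoly := pone l m A B with hP₁'
  set P₂ : RPoly := ptwo l m A B with hP₂'
  have hρ : ρ = X 0 ^ 2 + X 1 ^ 2 + X 2 ^ 2 := by rw [hρ']; rfl
  have hG : G = a0 * a0 + a1 * a1 + a2 * a2 := by rw [hG', ha0, ha1, ha2]; rfl
  have hH : H = a0 * b0 + a1 * b1 + a2 * b2 := by rw [hH', ha0, ha1, ha2, hb0, hb1, hb2]; rfl
  have hWq : Wq = ρ * G - C (l : ℝ) * C (l : ℝ) * A * A := by rw [hWq', hρ', hG']; rfl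
  have hP₁ : P₁ = C (m : ℝ) * B * G - C (l : ℝ) * A * H := by rw [hP₁', hG', hH']; rfl
  have hP₂ : P₂ = ρ * H - C (l : ℝ) * C (m : ℝ) * A * B := by rw [hP₂', hρ', hH']; rfl
  have sa01 : pderiv 1 a0 = pderiv 0 a1 := by rw [ha0, ha1, pderiv_comm_real]
  have sa02 : pderiv 2 a0 = pderiv 0 a2 := by rw [ha0, ha2, pderiv_comm_real]
  have sa12 : pderiv 2 a1 = pderiv 1 a2 := by rw [ha1, ha2, pderiv_comm_real]
  have sb01 : pderiv 1 b0 = pderiv 0 b1 := by rw [hb0, hb1, pderiv_comm_real]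
  have sb02 : pderiv 2 b0 = pderiv 0 b2 := by rw [hb0, hb2, pderiv_comm_real]
  have sb12 : pderiv 2 b1 = pderiv 1 b2 := by rw [hb1, hb2, pderiv_comm_real]
  have lapA : pderiv 0 a0 + pderiv 1 a1 + pderiv 2 a2 = 0 := by rw [ha0, ha1, ha2]; exact hlA
  have lapB : pderiv 0 b0 + pderiv 1 b1 + pderiv 2 b2 = 0 := by rw [hb0, hb1, hb2]; exact hlB
  have eA : X 0 * a0 + X 1 * a1 + X 2 * a2 = C (l : ℝ) * A := by rw [ha0, ha1, ha2, euler3 hA]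
  have eB : X 0 * b0 + X 1 * b1 + X 2 * b2 = C (m : ℝ) * B := by rw [hb0, hb1, hb2, euler3 hB]
  have hD' : (X 1 * a2 - X 2 * a1) * b0 + (X 2 * a0 - X 0 * a2) * b1 + (X 0 * a1 - X 1 * a0) * b2 = 0 := by
    rw [ha0, ha1, ha2, hb0, hb1, hb2, ← detP_eq_w, hD]
  have LdP : ∀ Q : RPoly, detP A Q = (X 1 * a2 - X 2 * a1) * pderiv 0 Q + (X 2 * a0 - X 0 * a2) * pderiv 1 Q
      + (X 0 * a1 - X 1 * a0) * pderiv 2 Q := fun Q => by rw [detP_eq_w]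
  set p0 := pv l m A B 0 with hp0'
  set p1 := pv l m A B 1 with hp1'
  set p2 := pv l m A B 2 with hp2'
  have hp0 : p0 = Wq * pderiv 0 P₂ - P₂ * pderiv 0 Wq := by rw [hp0', hWq', hP₂']; rfl
  have hp1 : p1 = Wq * pderiv 1 P₂ - P₂ * pderiv 1 Wq := by rw [hp1', hWq', hP₂']; rfl
  have hp2 : p2 = Wq * pderiv 2 P₂ - P₂ * pderiv 2 Wq := by rw [hp2', hWq', hP₂']; rfl
  set PX := pxs l m A B with hPX'
  set PA := pas l m A B with hPA'
  have hPX : PX = X 0 * p0 + X 1 * p1 + X 2 * p2 := by rw [hPX', hp0', hp1', hp2']; rfl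
  have hPA : PA = a0 * p0 + a1 * p1 + a2 * p2 := by rw [hPA', ha0, ha1, ha2, hp0', hp1', hp2']; rfl
  set c₁ := cone l m A B with hc₁'
  set M := mm l m A B with hM'
  have hc₁ : c₁ = PX * G - PA * (C (l : ℝ) * A) := by rw [hc₁', hPX', hPA', hG']; rfl
  have hM : M = PA * ρ - PX * (C (l : ℝ) * A) := by rw [hM', hPX', hPA', hρ']; rfl
  -- homogeneity of the composite polynomials (for Euler)
  have hρh : ρ.IsHomogeneous 2 := by
    rw [hρ]; exact ((isHomogeneous_X_pow 0 2).add (isHomogeneous_X_pow 1 2)).add (isHomogeneous_X_pow 2 2)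
  have hGh : G.IsHomogeneous (l - 1 + (l - 1)) := by
    rw [hG, ha0, ha1, ha2]
    exact ((hA.pderiv.mul hA.pderiv).add (hA.pderiv.mul hA.pderiv)).add (hA.pderiv.mul hA.pderiv)
  have hHh : H.IsHomogeneous (l - 1 + (m - 1)) := by
    rw [hH, ha0, ha1, ha2, hb0, hb1, hb2]
    exact ((hA.pderiv.mul hB.pderiv).add (hA.pderiv.mul hB.pderiv)).add (hA.pderiv.mul hB.pderiv)
  have hWqh : Wq.IsHomogeneous (2 * l) := by
    have h1 : (ρ * G).IsHomogeneous (2 * l) := by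
      have := hρh.mul hGh; rwa [show 2 + (l - 1 + (l - 1)) = 2 * l by omega] at this
    have h2 : (C (l : ℝ) * C (l : ℝ) * A * A).IsHomogeneous (2 * l) := by
      have := ((hA.C_mul (l : ℝ)).C_mul (l : ℝ)).mul hA
      rw [show l + l = 2 * l by omega] at this
      convert this using 2; ring
    rw [hWq]; exact h1.sub h2
  have hP₁h : P₁.IsHomogeneous (m + 2 * l - 2) := by
    have h1 : (C (m : ℝ) * B * G).IsHomogeneous (m + 2 * l - 2) := by
      have := (hB.C_mul (m : ℝ)).mul hGh; rwa [show m + (l - 1 + (l - 1)) = m + 2 * l - 2 by omega] at this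
    have h2 : (C (l : ℝ) * A * H).IsHomogeneous (m + 2 * l - 2) := by
      have := (hA.C_mul (l : ℝ)).mul hHh; rwa [show l + (l - 1 + (m - 1)) = m + 2 * l - 2 by omega] at this
    rw [hP₁]; exact h1.sub h2
  have hP₂h : P₂.IsHomogeneous (l + m) := by
    have h1 : (ρ * H).IsHomogeneous (l + m) := by
      have := hρh.mul hHh; rwa [show 2 + (l - 1 + (m - 1)) = l + m by omega] at this
    have h2 : (C (l : ℝ) * C (m : ℝ) * A * B).IsHomogeneous (l + m) := by
      have := ((hA.C_mul (m : ℝ)).C_mul (l : ℝ)).mul hB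
      convert this using 2; ring
    rw [hP₂]; exact h1.sub h2
  have eWq : X 0 * pderiv 0 Wq + X 1 * pderiv 1 Wq + X 2 * pderiv 2 Wq = C ((2 * l : ℕ) : ℝ) * Wq := euler3 hWqh
  have eP₁ : X 0 * pderiv 0 P₁ + X 1 * pderiv 1 P₁ + X 2 * pderiv 2 P₁ = C ((m + 2 * l - 2 : ℕ) : ℝ) * P₁ := euler3 hP₁h
  have eP₂ : X 0 * pderiv 0 P₂ + X 1 * pderiv 1 P₂ + X 2 * pderiv 2 P₂ = C ((l + m : ℕ) : ℝ) * P₂ := euler3 hP₂h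
  have castP₁ : (C ((m + 2 * l - 2 : ℕ) : ℝ) : RPoly) = C (m : ℝ) + C 2 * C (l : ℝ) - C 2 := by
    rw [← map_mul, ← map_add, ← map_sub]; congr 1; rw [Nat.cast_sub (by omega), Nat.cast_add, Nat.cast_mul]; push_cast; ring
  have castWq : (C ((2 * l : ℕ) : ℝ) : RPoly) = C 2 * C (l : ℝ) := by rw [← map_mul]; congr 1; push_cast; ring
  have castP₂ : (C ((l + m : ℕ) : ℝ) : RPoly) = C (l : ℝ) + C (m : ℝ) := by rw [← map_add]; congr 1; push_cast; ring
  rw [castP₁] at eP₁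
  rw [castWq] at eWq
  rw [castP₂] at eP₂
  set N := nn l m A B with hN'
  have hN : N = (C (m : ℝ) + 1) * ρ * P₁ + C (l : ℝ) * (C (m : ℝ) - C (l : ℝ)) * A * P₂ := by rw [hN', hρ', hP₁', hP₂']; rfl
  -- `M = −Wq N`
  have hPA2 : PA = -((C (m : ℝ) + 1) * P₁ * Wq) := by
    rw [hPA, hp0, hp1, hp2]; linear_combination I3
  have hPX2 : PX = (C (m : ℝ) - C (l : ℝ)) * P₂ * Wq := by
    have hC2 : (C (2 : ℝ) : RPoly) = 2 := map_ofNat C 2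
    rw [hC2] at eWq
    rw [hPX, hp0, hp1, hp2]; linear_combination Wq * eP₂ - P₂ * eWq
  have hMN : M = -(Wq * N) := by rw [hM, hPA2, hPX2, hN]; ring
  -- `L Wq = ρ · L G`
  have h1 : detP A (ρ * G) = ρ * detP A G := by rw [detP_mul_right, hρ, detP_rho]; ring
  have h2 : detP A (C (l : ℝ) * C (l : ℝ) * A * A) = 0 := by
    rw [detP_eq_w]; simp only [Derivation.leibniz, pderiv_C, smul_eq_mul, mul_zero, add_zero]; ring
  have hLWq : detP A Wq = ρ * detP A G := by rw [hWq, detP_sub_right, h1, h2, sub_zero]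
  -- flatness of `N`
  have hLN : Wq * detP A N = N * detP A Wq := by
    have g1 : detP A ((C (m : ℝ) + 1) * ρ * P₁) = (C (m : ℝ) + 1) * ρ * detP A P₁ := by
      rw [detP_mul_right, detP_mul_right, hρ, detP_rho]
      have : detP A (C (m : ℝ) + 1 : RPoly) = 0 := by rw [detP_eq_w]; simp
      rw [this]; ring
    have g2 : detP A (C (l : ℝ) * (C (m : ℝ) - C (l : ℝ)) * A * P₂) = C (l : ℝ) * (C (m : ℝ) - C (l : ℝ)) * A * detP A P₂ := by
      rw [detP_mul_right, detP_mul_right, detP_self]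
      have : detP A (C (l : ℝ) * (C (m : ℝ) - C (l : ℝ)) : RPoly) = 0 := by
        rw [detP_eq_w]; simp [map_sub]
      rw [this]; ring
    rw [hN, detP_add_right, g1, g2]
    linear_combination ((C (m : ℝ) + 1) * ρ) * F1 + (C (l : ℝ) * (C (m : ℝ) - C (l : ℝ)) * A) * F2
  -- combine with I8
  have hLM : detP A M = -(N * detP A Wq + Wq * detP A N) := by
    rw [hMN, detP_neg_right, detP_mul_right]; ring
  have hWq0 : Wq ≠ 0 := by
    rw [hWq, hρ, hG, ha0, ha1, ha2]; exact wq_ne_zero hA hl hlA hA0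
  have key : Wq * (N * detP A Wq) = Wq * 0 := by
    have h := I8
    rw [hLM, hMN] at h
    linear_combination h + Wq * hLN
  have key2 : N * detP A Wq = 0 := mul_left_cancel₀ hWq0 key
  have hZ : DP A = detP A G := by rw [hG']; rfl
  rw [hZ, ← hLWq]
  exact key2


/-- Stage N1: on the branch `N = 0`, `m(m+1)·B·Wq = l(l+1)·A·P₂` and `M = 0`. -/
theorem stageN1 (hl : 1 ≤ l) (hm : 1 ≤ m) (hA : A.IsHomogeneous l) (hB : B.IsHomogeneous m)
    (hlA : lapP A = 0) (hlB : lapP B = 0) (hD : detP A B = 0) (hN0 : nn l m A B = 0) :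
    C (m : ℝ) * (C (m : ℝ) + 1) * B * wq l A = C (l : ℝ) * (C (l : ℝ) + 1) * A * ptwo l m A B ∧ mm l m A B = 0 := by
  obtain ⟨E0, E1, E2⟩ := stageE hA hB hlA hlB hD
  have I3 := stageI3 hl hm hA hB hlA hlB hD
  set a0 := pderiv 0 A with ha0
  set a1 := pderiv 1 A with ha1
  set a2 := pderiv 2 A with ha2
  set b0 := pderiv 0 B with hb0
  set b1 := pderiv 1 B with hb1
  set b2 := pderiv 2 B with hb2
  set ρ : RPoly := rhoP with hρ'
  set G : RPoly := gP A with hG'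
  set H : RPoly := hP A B with hH'
  set Wq : RPoly := wq l A with hWq'
  set P₁ : RPoly := pone l m A B with hP₁'
  set P₂ : RPoly := ptwo l m A B with hP₂'
  have hρ : ρ = X 0 ^ 2 + X 1 ^ 2 + X 2 ^ 2 := by rw [hρ']; rfl
  have hG : G = a0 * a0 + a1 * a1 + a2 * a2 := by rw [hG', ha0, ha1, ha2]; rfl
  have hH : H = a0 * b0 + a1 * b1 + a2 * b2 := by rw [hH', ha0, ha1, ha2, hb0, hb1, hb2]; rfl
  have hWq : Wq = ρ * G - C (l : ℝ) * C (l : ℝ) * A * A := by rw [hWq', hρ', hG']; rfl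
  have hP₁ : P₁ = C (m : ℝ) * B * G - C (l : ℝ) * A * H := by rw [hP₁', hG', hH']; rfl
  have hP₂ : P₂ = ρ * H - C (l : ℝ) * C (m : ℝ) * A * B := by rw [hP₂', hρ', hH']; rfl
  have sa01 : pderiv 1 a0 = pderiv 0 a1 := by rw [ha0, ha1, pderiv_comm_real]
  have sa02 : pderiv 2 a0 = pderiv 0 a2 := by rw [ha0, ha2, pderiv_comm_real]
  have sa12 : pderiv 2 a1 = pderiv 1 a2 := by rw [ha1, ha2, pderiv_comm_real]
  have sb01 : pderiv 1 b0 = pderiv 0 b1 := by rw [hb0, hb1, pderiv_comm_real]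
  have sb02 : pderiv 2 b0 = pderiv 0 b2 := by rw [hb0, hb2, pderiv_comm_real]
  have sb12 : pderiv 2 b1 = pderiv 1 b2 := by rw [hb1, hb2, pderiv_comm_real]
  have lapA : pderiv 0 a0 + pderiv 1 a1 + pderiv 2 a2 = 0 := by rw [ha0, ha1, ha2]; exact hlA
  have lapB : pderiv 0 b0 + pderiv 1 b1 + pderiv 2 b2 = 0 := by rw [hb0, hb1, hb2]; exact hlB
  have eA : X 0 * a0 + X 1 * a1 + X 2 * a2 = C (l : ℝ) * A := by rw [ha0, ha1, ha2, euler3 hA]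
  have eB : X 0 * b0 + X 1 * b1 + X 2 * b2 = C (m : ℝ) * B := by rw [hb0, hb1, hb2, euler3 hB]
  have hD' : (X 1 * a2 - X 2 * a1) * b0 + (X 2 * a0 - X 0 * a2) * b1 + (X 0 * a1 - X 1 * a0) * b2 = 0 := by
    rw [ha0, ha1, ha2, hb0, hb1, hb2, ← detP_eq_w, hD]
  have LdP : ∀ Q : RPoly, detP A Q = (X 1 * a2 - X 2 * a1) * pderiv 0 Q + (X 2 * a0 - X 0 * a2) * pderiv 1 Q
      + (X 0 * a1 - X 1 * a0) * pderiv 2 Q := fun Q => by rw [detP_eq_w]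
  set p0 := pv l m A B 0 with hp0'
  set p1 := pv l m A B 1 with hp1'
  set p2 := pv l m A B 2 with hp2'
  have hp0 : p0 = Wq * pderiv 0 P₂ - P₂ * pderiv 0 Wq := by rw [hp0', hWq', hP₂']; rfl
  have hp1 : p1 = Wq * pderiv 1 P₂ - P₂ * pderiv 1 Wq := by rw [hp1', hWq', hP₂']; rfl
  have hp2 : p2 = Wq * pderiv 2 P₂ - P₂ * pderiv 2 Wq := by rw [hp2', hWq', hP₂']; rfl
  set PX := pxs l m A B with hPX'
  set PA := pas l m A B with hPA'
  have hPX : PX = X 0 * p0 + X 1 * p1 + X 2 * p2 := by rw [hPX', hp0', hp1', hp2']; rfl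
  have hPA : PA = a0 * p0 + a1 * p1 + a2 * p2 := by rw [hPA', ha0, ha1, ha2, hp0', hp1', hp2']; rfl
  set c₁ := cone l m A B with hc₁'
  set M := mm l m A B with hM'
  have hc₁ : c₁ = PX * G - PA * (C (l : ℝ) * A) := by rw [hc₁', hPX', hPA', hG']; rfl
  have hM : M = PA * ρ - PX * (C (l : ℝ) * A) := by rw [hM', hPX', hPA', hρ']; rfl
  -- homogeneity of the composite polynomials (for Euler)
  have hρh : ρ.IsHomogeneous 2 := by
    rw [hρ]; exact ((isHomogeneous_X_pow 0 2).add (isHomogeneous_X_pow 1 2)).add (isHomogeneous_X_pow 2 2)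
  have hGh : G.IsHomogeneous (l - 1 + (l - 1)) := by
    rw [hG, ha0, ha1, ha2]
    exact ((hA.pderiv.mul hA.pderiv).add (hA.pderiv.mul hA.pderiv)).add (hA.pderiv.mul hA.pderiv)
  have hHh : H.IsHomogeneous (l - 1 + (m - 1)) := by
    rw [hH, ha0, ha1, ha2, hb0, hb1, hb2]
    exact ((hA.pderiv.mul hB.pderiv).add (hA.pderiv.mul hB.pderiv)).add (hA.pderiv.mul hB.pderiv)
  have hWqh : Wq.IsHomogeneous (2 * l) := by
    have h1 : (ρ * G).IsHomogeneous (2 * l) := by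
      have := hρh.mul hGh; rwa [show 2 + (l - 1 + (l - 1)) = 2 * l by omega] at this
    have h2 : (C (l : ℝ) * C (l : ℝ) * A * A).IsHomogeneous (2 * l) := by
      have := ((hA.C_mul (l : ℝ)).C_mul (l : ℝ)).mul hA
      rw [show l + l = 2 * l by omega] at this
      convert this using 2; ring
    rw [hWq]; exact h1.sub h2
  have hP₁h : P₁.IsHomogeneous (m + 2 * l - 2) := by
    have h1 : (C (m : ℝ) * B * G).IsHomogeneous (m + 2 * l - 2) := by
      have := (hB.C_mul (m : ℝ)).mul hGh; rwa [show m + (l - 1 + (l - 1)) = m + 2 * l - 2 by omega] at this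
    have h2 : (C (l : ℝ) * A * H).IsHomogeneous (m + 2 * l - 2) := by
      have := (hA.C_mul (l : ℝ)).mul hHh; rwa [show l + (l - 1 + (m - 1)) = m + 2 * l - 2 by omega] at this
    rw [hP₁]; exact h1.sub h2
  have hP₂h : P₂.IsHomogeneous (l + m) := by
    have h1 : (ρ * H).IsHomogeneous (l + m) := by
      have := hρh.mul hHh; rwa [show 2 + (l - 1 + (m - 1)) = l + m by omega] at this
    have h2 : (C (l : ℝ) * C (m : ℝ) * A * B).IsHomogeneous (l + m) := by
      have := ((hA.C_mul (m : ℝ)).C_mul (l : ℝ)).mul hB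
      convert this using 2; ring
    rw [hP₂]; exact h1.sub h2
  have eWq : X 0 * pderiv 0 Wq + X 1 * pderiv 1 Wq + X 2 * pderiv 2 Wq = C ((2 * l : ℕ) : ℝ) * Wq := euler3 hWqh
  have eP₁ : X 0 * pderiv 0 P₁ + X 1 * pderiv 1 P₁ + X 2 * pderiv 2 P₁ = C ((m + 2 * l - 2 : ℕ) : ℝ) * P₁ := euler3 hP₁h
  have eP₂ : X 0 * pderiv 0 P₂ + X 1 * pderiv 1 P₂ + X 2 * pderiv 2 P₂ = C ((l + m : ℕ) : ℝ) * P₂ := euler3 hP₂h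
  have castP₁ : (C ((m + 2 * l - 2 : ℕ) : ℝ) : RPoly) = C (m : ℝ) + C 2 * C (l : ℝ) - C 2 := by
    rw [← map_mul, ← map_add, ← map_sub]; congr 1; rw [Nat.cast_sub (by omega), Nat.cast_add, Nat.cast_mul]; push_cast; ring
  have castWq : (C ((2 * l : ℕ) : ℝ) : RPoly) = C 2 * C (l : ℝ) := by rw [← map_mul]; congr 1; push_cast; ring
  have castP₂ : (C ((l + m : ℕ) : ℝ) : RPoly) = C (l : ℝ) + C (m : ℝ) := by rw [← map_add]; congr 1; push_cast; ring
  rw [castP₁] at eP₁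
  rw [castWq] at eWq
  rw [castP₂] at eP₂
  set N := nn l m A B with hN'
  have hN : N = (C (m : ℝ) + 1) * ρ * P₁ + C (l : ℝ) * (C (m : ℝ) - C (l : ℝ)) * A * P₂ := by rw [hN', hρ', hP₁', hP₂']; rfl
  -- `M = −Wq N`
  have hPA2 : PA = -((C (m : ℝ) + 1) * P₁ * Wq) := by
    rw [hPA, hp0, hp1, hp2]; linear_combination I3
  have hPX2 : PX = (C (m : ℝ) - C (l : ℝ)) * P₂ * Wq := by
    have hC2 : (C (2 : ℝ) : RPoly) = 2 := map_ofNat C 2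
    rw [hC2] at eWq
    rw [hPX, hp0, hp1, hp2]; linear_combination Wq * eP₂ - P₂ * eWq
  have hMN : M = -(Wq * N) := by rw [hM, hPA2, hPX2, hN]; ring
  have hN0' : N = 0 := by rw [hN']; exact hN0
  have hx : C (m : ℝ) * B * Wq = ρ * P₁ + C (l : ℝ) * A * P₂ := by
    rw [hρ]; linear_combination X 0 * E0 + X 1 * E1 + X 2 * E2 - Wq * eB + P₂ * eA
  refine ⟨?_, by rw [hMN, hN0', mul_zero, neg_zero]⟩
  have h := hN0'; rw [hN] at h
  linear_combination (C (m : ℝ) + 1) * hx + h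

end Stages

end Summit.NavierStokesRegularity.NavierStokesRegularity.Theorems.PoloidalLiouville.HorizonTower.Zonal

end
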